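import Summits.ResolutionOfSingularities.ResolutionOfSingularities.Theorems.MarkedTransferCampaignW36VeroneseReach
import Literature.AlgebraicGeometry.Hironaka2017.Lib.FamilySubalgebraVeronese
import HarnessLib

/-!
# [L1 W3.6 · SYMBOLIC-FG DOOR, def-free half] On a Noetherian scheme the Veronese shape of the W3.6 door is EQUIVALENT to finite
# generation of the symbolic (differential-power) algebra `⊕_d 𝓘_C^{⟨d⟩}(U) X^d` on every affine open `U`; hence `Ě` exists along every
# cut of the `Inv_max`-stratum whose symbolic algebra is finitely generated — a door strictly containing the class 𝒞

Cell `res-hironaka`, rung L, slot W3.6 lineage (seat res-L1-s36-pv-1, g1); GAP-LEDGER R12/12a residual ⟨StableTower⟩ OFF the class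
`𝒞 = LCIOrMonomialClass`. HOST item stmt-ResolutionOfSingularities-16155 via `--supports`. HONEST FRAMING (D-0012/D-0089): kernel theorems
about OUR typed carriers — res-type-010's `S06BaseHike.diffPower` / `focusAt` / `StableAt` / `IsCoreFocus`, row 003's rendering device
`S04CharAlgebra.familySubalgebra` (the Rees-type algebra `⊕ Q_d X^d ⊆ O[X]`, the carrier of the typed `U16_1`), o4's door shapes (p488503),
this seat's T-AB (p494780). Nothing printed in [Hironaka2017] is asserted (the manuscript prints no existence argument for `Ě`, §6.2 p.30
l.4–9) and the manuscript stays «under review». AI-produced; weaker than expert review.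

WHAT THIS FILE ADDS (all def-free; the class-level packaging `SymbolicFGClass` follows in a Defs file).
* Sections-level bookkeeping `ideal_diffPower_zero/_mul_le/_antitone/_veronese`: on an affine open `U` the family
  `d ↦ 𝓘_C^{⟨d⟩}(U)` is a decreasing multiplicative filtration of `Γ(Z,U)` with top in degree `0`.
* **`symbolicAlgebra_fg_of_veronese`** (locally Noetherian `Z`): the door's Veronese shape `∀ k, 𝓘_C^{⟨k b₀⟩} ≤ (𝓘_C^{⟨b₀⟩})^k` ⇒
  `⊕_d 𝓘_C^{⟨d⟩}(U) X^d` is a finitely generated `Γ(Z,U)`-algebra for every affine open `U` (HHT Thm 2.1 (b) ⇒ (a), p525028).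
* **`veronese_of_symbolicAlgebra_fg`** (Noetherian `Z`): conversely, finite generation on every affine open ⇒ the Veronese shape at a
  COMMON level (HHT Thm 2.1 (a) ⇒ (b) per affine open, a finite affine subcover, the product of the levels — `veronese_le_pow_mul` —, and
  `le_of_forall_stalkIdeal_le`); **`veronese_iff_symbolicAlgebra_fg`** — the two are EQUIVALENT: the reach of the W3.6 method is EXACTLY the
  locus of cuts with finitely generated symbolic algebra.
* **`exists_stableAt_of_symbolicAlgebra_fg`**, **`exists_isCoreFocus_of_symbolicAlgebra_fg`** — ⟨StableTower⟩ and the (43)-object `Ě`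
  (res-type-010's `stableAt_of_veronese` / `exists_isCoreFocus_of_veroneseCut_ambient`) along every cut `C` of the `Inv_max`-stratum whose
  symbolic algebra is finitely generated on the affine opens: the SYMBOLIC-FG DOOR per instance. It CONTAINS the W3.6 door:
  **`symbolicAlgebra_fg_lciOrMonomial`** — every everywhere-(l.c.i. or monomial) cut of an ambient datum has finitely generated symbolic
  algebra on every affine open (T-AB p494780 ∘ `symbolicAlgebra_fg_of_veronese`), unconditionally.
* rev 2 appendix (COVER / AFFINE forms): `veronese_of_symbolicAlgebra_fg_cover` (f.g. on ONE finite affine cover suffices; locally Noetherian,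
  no compactness), `symbolicAlgebra_fg_of_cover`, `veronese_iff_symbolicAlgebra_fg_top` / `symbolicAlgebra_fg_iff_top` (affine ambient: the
  single algebra `⊕_d 𝓘_C^{⟨d⟩}(Z) X^d` decides) — for the cone/specimen programme on `𝔸ⁿ⁺¹` (res-L1-s36-pv-2, res-type-009's device).
READ AGAINST res-type-010's `U30L4fSymbolicFG` (p488059: `IsCoreFocus … Ě ∧ U16_1(Ě) ⇒` the same finite generation for `Σ̄_max`): granted the
manuscript's own import `U16_1` (finite generation of `℘`, [23] = F-21f) at `Ě`, the existence of `Ě` is EQUIVALENT to «symbolic algebra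
of `Σ̄_max(Ê)` finitely generated on the affine opens» (⇐ unconditional, here; ⇒ modulo F-21f, there) — so off 𝒞 the residual
⟨StableTower⟩ of R12/12a is a classical finite-generation property, known to FAIL for some closed subsets of regular varieties even in
positive characteristic (Sannai–Tanaka 2019 Thm 3.7; Kurano et al. 2025 Ex. 1.4 (2)) — not formalised here; no verdict.
-/

noncomputable section

set_option linter.dupNamespace false -- mandated namespace of this single-conjunct summit

open _root_.AlgebraicGeometry _root_.TopologicalSpace _root_.CategoryTheory _root_.IsLocalRing

namespace Summit.ResolutionOfSingularities.ResolutionOfSingularities.Theorems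

open Literature.AlgebraicGeometry.Resolution
open Literature.AlgebraicGeometry.Hironaka2017
open Literature.AlgebraicGeometry.Hironaka2017.S02Preliminaries
open Literature.AlgebraicGeometry.Hironaka2017.S04CharAlgebra
open Literature.AlgebraicGeometry.Hironaka2017.S06BaseHike
open Literature.AlgebraicGeometry.Hironaka2017.Datum
open Literature.RingTheory.GradedAlgebra
open Scheme.IdealSheafData

universe u

namespace CampaignW36

/-! ## The symbolic family on an affine open is a decreasing multiplicative filtration -/

section Sections

variable {Z : Scheme.{u}}

/-- `𝓘_C^{⟨0⟩}(U) = Γ(Z,U)` (res-type-010's `diffPower_zero`, sections). OURS carrier bookkeeping. [folklore] -/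
theorem ideal_diffPower_zero (C : Closeds Z) (U : Z.affineOpens) : (diffPower C 0).ideal U = ⊤ := by
  rw [S06BaseHike.diffPower_zero, Scheme.IdealSheafData.ideal_top, Pi.top_apply]

/-- `𝓘_C^{⟨a⟩}(U) · 𝓘_C^{⟨b⟩}(U) ≤ 𝓘_C^{⟨a+b⟩}(U)` (res-type-010's `diffPower_mul_le`, sections). OURS carrier bookkeeping. [folklore] -/
theorem ideal_diffPower_mul_le (C : Closeds Z) (U : Z.affineOpens) (a b : ℕ) :
    (diffPower C a).ideal U * (diffPower C b).ideal U ≤ (diffPower C (a + b)).ideal U := by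
  rw [← Pi.mul_apply, ← Scheme.IdealSheafData.ideal_mul]
  exact Scheme.IdealSheafData.le_def.mp (diffPower_mul_le C a b) U

/-- `d ↦ 𝓘_C^{⟨d⟩}(U)` decreases. OURS carrier bookkeeping. [folklore] -/
theorem ideal_diffPower_antitone (C : Closeds Z) (U : Z.affineOpens) : Antitone fun n => (diffPower C n).ideal U :=
  fun _ _ hab => Scheme.IdealSheafData.le_def.mp (diffPower_antitone C hab) U

/-- The door's Veronese shape, sections: `𝓘_C^{⟨k b₀⟩}(U) ≤ (𝓘_C^{⟨b₀⟩}(U))^k`. OURS carrier bookkeeping. [folklore] -/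
theorem ideal_diffPower_veronese (C : Closeds Z) {b₀ : ℕ} (hver : ∀ k : ℕ, diffPower C (k * b₀) ≤ diffPower C b₀ ^ k)
    (U : Z.affineOpens) (k : ℕ) : (diffPower C (k * b₀)).ideal U ≤ (diffPower C b₀).ideal U ^ k := by
  have h := Scheme.IdealSheafData.le_def.mp (hver k) U
  rwa [Scheme.IdealSheafData.ideal_pow, Pi.pow_apply] at h

/-! ## Veronese shape ⟺ finitely generated symbolic algebra on the affine opens -/

/-- **[OURS · L1 W3.6] (⇒) The door's Veronese shape makes the symbolic algebra finitely generated on every affine open.** On a locally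
Noetherian scheme, if `𝓘_C^{⟨k b₀⟩} ≤ (𝓘_C^{⟨b₀⟩})^k` for all `k` (some `b₀ > 0`), then for every affine open `U` row 003's Rees-type algebra
`⊕_d 𝓘_C^{⟨d⟩}(U) X^d = familySubalgebra Γ(Z,U) (d ↦ 𝓘_C^{⟨d⟩}(U))` is a finitely generated `Γ(Z,U)`-algebra (HHT Thm 2.1 (b) ⇒ (a) in the
tree's form, p525028 `familySubalgebra_fg_of_veronese`). NOT a statement of the manuscript. [cite: HerzogHibiTrung2007, Thm 2.1 (b) ⇒ (a)] -/
theorem symbolicAlgebra_fg_of_veronese [IsLocallyNoetherian Z] (C : Closeds Z) {b₀ : ℕ} (hb₀ : 0 < b₀)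
    (hver : ∀ k : ℕ, diffPower C (k * b₀) ≤ diffPower C b₀ ^ k) (U : Z.affineOpens) :
    (familySubalgebra Γ(Z, U) fun d => (diffPower C d).ideal U).FG := by
  haveI : IsNoetherianRing Γ(Z, U) := IsLocallyNoetherian.component_noetherian U
  exact familySubalgebra_fg_of_veronese (fun d => (diffPower C d).ideal U) (ideal_diffPower_zero C U)
    (ideal_diffPower_mul_le C U) (ideal_diffPower_antitone C U) hb₀ (ideal_diffPower_veronese C hver U)

/-- **[OURS · L1 W3.6] (⇐) Finitely generated symbolic algebra on the affine opens gives the door's Veronese shape.** On a Noetherian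
scheme, if for every affine open `U` the algebra `⊕_d 𝓘_C^{⟨d⟩}(U) X^d` is finitely generated over `Γ(Z,U)`, then there is ONE level
`b₀ > 0` with `𝓘_C^{⟨k b₀⟩} ≤ (𝓘_C^{⟨b₀⟩})^k` for all `k`: HHT Thm 2.1 (a) ⇒ (b) per affine open (p525028
`exists_veronese_of_familySubalgebra_fg`), a finite affine subcover (quasi-compactness), the product of the levels
(`veronese_le_pow_mul`), and an ideal-sheaf inequality checked on stalks (`le_of_forall_stalkIdeal_le`). NOT a statement of the manuscript.
[cite: HerzogHibiTrung2007, Thm 2.1 (a) ⇒ (b)] [cite: EGAII, Prop (2.1.6)] -/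
theorem veronese_of_symbolicAlgebra_fg [IsNoetherian Z] (C : Closeds Z)
    (hFG : ∀ U : Z.affineOpens, (familySubalgebra Γ(Z, U) fun d => (diffPower C d).ideal U).FG) :
    ∃ b₀ : ℕ, 0 < b₀ ∧ ∀ k : ℕ, diffPower C (k * b₀) ≤ diffPower C b₀ ^ k := by
  classical
  -- an affine open neighbourhood of every point
  have hU : ∀ x : Z, ∃ U : Z.affineOpens, x ∈ (U : Z.Opens) := fun x => by
    obtain ⟨U, hU, hxU, -⟩ :=
      exists_isAffineOpen_mem_and_subset (X := Z) (x := x) (U := ⊤) (Opens.mem_top x)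
    exact ⟨⟨U, hU⟩, hxU⟩
  choose U hxU using hU
  -- finitely many of them cover
  obtain ⟨t, ht⟩ := CompactSpace.elim_nhds_subcover (fun x => ((U x : Z.Opens) : Set Z))
    fun x => (U x).1.isOpen.mem_nhds (hxU x)
  -- a standard Veronese level on each of them
  have hlev : ∀ x : Z, ∃ h : ℕ, 0 < h ∧
      ∀ k : ℕ, (diffPower C (k * h)).ideal (U x) ≤ (diffPower C h).ideal (U x) ^ k := by
    intro x
    obtain ⟨h, hh, hV⟩ := exists_veronese_of_familySubalgebra_fg (fun d => (diffPower C d).ideal (U x))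
      (ideal_diffPower_zero C (U x)) (ideal_diffPower_mul_le C (U x)) (hFG (U x))
    exact ⟨h, hh, fun k => by rw [mul_comm]; exact (hV k).le⟩
  choose h hh hV using hlev
  -- the common level: the product over the finite subcover
  refine ⟨∏ x ∈ t, h x, Finset.prod_pos fun x _ => hh x, fun k => ?_⟩
  refine le_of_forall_stalkIdeal_le fun y => ?_
  have hy : y ∈ ⋃ x ∈ t, ((U x : Z.Opens) : Set Z) := by
    rw [ht]
    trivial
  obtain ⟨x, hxt, hyx⟩ := Set.mem_iUnion₂.mp hy
  have hVx : ∀ k : ℕ, (diffPower C (k * ∏ x ∈ t, h x)).ideal (U x) ≤ (diffPower C (∏ x ∈ t, h x)).ideal (U x) ^ k := by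
    intro k
    rw [← Finset.mul_prod_erase t h hxt, mul_comm (h x)]
    exact veronese_le_pow_mul (fun d => (diffPower C d).ideal (U x)) (ideal_diffPower_zero C (U x))
      (ideal_diffPower_mul_le C (U x)) (hV x) _ k
  rw [stalkIdeal_eq_map_germ _ (U x) hyx, stalkIdeal_pow, stalkIdeal_eq_map_germ _ (U x) hyx, ← Ideal.map_pow]
  exact Ideal.map_mono (hVx k)

/-- **[OURS · L1 W3.6] THE REACH OF THE W3.6 METHOD IS EXACT.** On a Noetherian scheme: the door's Veronese shape at `C` (some level
`b₀ > 0`) ⟺ the symbolic algebra `⊕_d 𝓘_C^{⟨d⟩}(U) X^d` is finitely generated on every affine open `U`. NOT a statement of the manuscript.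
[cite: HerzogHibiTrung2007, Thm 2.1] -/
theorem veronese_iff_symbolicAlgebra_fg [IsNoetherian Z] (C : Closeds Z) :
    (∃ b₀ : ℕ, 0 < b₀ ∧ ∀ k : ℕ, diffPower C (k * b₀) ≤ diffPower C b₀ ^ k) ↔
      ∀ U : Z.affineOpens, (familySubalgebra Γ(Z, U) fun d => (diffPower C d).ideal U).FG :=
  ⟨fun ⟨_, hb₀, hver⟩ U => symbolicAlgebra_fg_of_veronese C hb₀ hver U, veronese_of_symbolicAlgebra_fg C⟩

/-- **[OURS · L1 W3.6] ⟨StableTower⟩ from finite generation.** On a regular Noetherian scheme, for `Ê` with `0 < Ê.b` and a closed `C`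
whose symbolic algebra is finitely generated on every affine open, the tower of candidates over `C` is stable at some positive level
(res-type-010's `stableAt_of_veronese`). NOT a statement of the manuscript. [cite: HerzogHibiTrung2007, Thm 2.1 (a) ⇒ (b)] -/
theorem exists_stableAt_of_symbolicAlgebra_fg [IsNoetherian Z] (hR : Scheme.IsRegular Z) (Ehat : IdealExponent Z)
    (hd : 0 < Ehat.b) (C : Closeds Z)
    (hFG : ∀ U : Z.affineOpens, (familySubalgebra Γ(Z, U) fun d => (diffPower C d).ideal U).FG) :
    ∃ b₀ : ℕ, 0 < b₀ ∧ StableAt Ehat C b₀ := by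
  obtain ⟨b₀, hb₀, hver⟩ := veronese_of_symbolicAlgebra_fg C hFG
  exact ⟨b₀, hb₀, stableAt_of_veronese hR Ehat hd C hb₀ hver⟩

end Sections

/-! ## The SYMBOLIC-FG door on the ambient datum, per instance; it contains the class 𝒞 -/

section Ambient

variable {p : ℕ} [Fact p.Prime] {K : Type u} [Field K] [CharP K p]

/-- The ambient scheme of a row-001 `AmbientDatum` is Noetherian. [folklore] -/
private theorem ambient_isNoetherian'' (A : AmbientDatum p K) : IsNoetherian A.Z :=
  -- adapted from Literature/AlgebraicGeometry/Hironaka2017/Lib/CoreFocusVeronese.lean (private `ambient_isNoetherian'`)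
  haveI := A.smooth
  haveI := A.quasiCompact
  Scheme.isNoetherian_of_finiteType_over_field A.hom

/-- **[OURS · L1 W3.6] THE SYMBOLIC-FG DOOR, per instance.** On the ambient datum `A` (row 001), for `Ê` with `0 < Ê.b` and any `inv`: if
the closed cut `C` of the `Inv_max`-stratum (`C ∩ Sing(Ê)_cl = Σ_max`, `C ⊆ Σ̄_max`) has finitely generated symbolic algebra
`⊕_d 𝓘_C^{⟨d⟩}(U) X^d` on every affine open `U`, then a core focusing `Ě` of `Ê` exists (`focusAt Ê C b₀` at the common Veronese level;
res-type-010's `exists_isCoreFocus_of_veroneseCut_ambient`). Strictly contains the W3.6 door (`symbolicAlgebra_fg_lciOrMonomial`). NOT a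
statement of the manuscript. [cite: HerzogHibiTrung2007, Thm 2.1 (a) ⇒ (b)] -/
theorem exists_isCoreFocus_of_symbolicAlgebra_fg (A : AmbientDatum p K) {n : ℕ}
    (inv : IdealExponent A.Z → A.Z → EdgeInv n) (Ehat : IdealExponent A.Z) (hd : 0 < Ehat.b) (C : Closeds A.Z)
    (hFG : ∀ U : A.Z.affineOpens, (familySubalgebra Γ(A.Z, U) fun d => (diffPower C d).ideal U).FG)
    (hC : (C : Set A.Z) ∩ (Ehat.sing ∩ S02Preliminaries.closedPoints A.Z) =
      invmaxStratum (Ehat.sing ∩ S02Preliminaries.closedPoints A.Z) (inv Ehat))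
    (hCcl : (C : Set A.Z) ⊆ closure (invmaxStratum (Ehat.sing ∩ S02Preliminaries.closedPoints A.Z) (inv Ehat))) :
    ∃ Echeck : IdealExponent A.Z, IsCoreFocus S04CharAlgebra.pAlg inv Ehat Echeck := by
  haveI := ambient_isNoetherian'' A
  obtain ⟨b₀, hb₀, hver⟩ := veronese_of_symbolicAlgebra_fg C hFG
  exact exists_isCoreFocus_of_veroneseCut_ambient A inv Ehat hd ⟨C, b₀, hb₀, hver, hC, hCcl⟩

/-- **[OURS · L1 W3.6] 𝒞 ⊆ SYMBOLIC-FG, unconditionally.** On an ambient datum, every closed `C ⊆ A.Z` that is an l.c.i. cut or a monomial cut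
at each of its points has finitely generated symbolic algebra `⊕_d 𝓘_C^{⟨d⟩}(U) X^d` on every affine open `U` (T-AB
`veroneseOfLCIOrMonomialCutOn_holds`, p494780 ∘ `symbolicAlgebra_fg_of_veronese`). NOT a statement of the manuscript.
[cite: HerzogHibiTrung2007, Thm 2.1, Cor. 2.2] -/
theorem symbolicAlgebra_fg_lciOrMonomial (A : AmbientDatum p K) (C : Closeds A.Z)
    (hC : ∀ x ∈ (C : Set A.Z), IsLCICutAt C x ∨ IsMonomialCutAt C x) (U : A.Z.affineOpens) :
    (familySubalgebra Γ(A.Z, U) fun d => (diffPower C d).ideal U).FG := by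
  haveI := ambient_isNoetherian'' A
  obtain ⟨b₀, hb₀, hver⟩ := veroneseOfLCIOrMonomialCutOn_holds A C hC
  exact symbolicAlgebra_fg_of_veronese C hb₀ hver U

/-- The B-type slice: everywhere-MONOMIAL cuts have finitely generated symbolic algebra on every affine open (T-B p494780 ∘ (⇒)).
NOT a statement of the manuscript. [cite: HerzogHibiTrung2007, Thm 2.1, Cor. 2.2] -/
theorem symbolicAlgebra_fg_monomial (A : AmbientDatum p K) (C : Closeds A.Z)
    (hC : ∀ x ∈ (C : Set A.Z), IsMonomialCutAt C x) (U : A.Z.affineOpens) :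
    (familySubalgebra Γ(A.Z, U) fun d => (diffPower C d).ideal U).FG := by
  haveI := ambient_isNoetherian'' A
  obtain ⟨b₀, hb₀, hver⟩ := veroneseOfMonomialCutOn_holds A C hC
  exact symbolicAlgebra_fg_of_veronese C hb₀ hver U

end Ambient

/-! ## Appendix (rev 2): COVER and AFFINE forms — finite generation on ONE finite affine cover suffices; on an affine ambient the
whole condition is the finite generation of ONE algebra `⊕_d 𝓘_C^{⟨d⟩}(Z) X^d` -/

section Cover

variable {Z : Scheme.{u}}

/-- **(⇐), COVER FORM** (locally Noetherian `Z`, no compactness needed): if the symbolic algebra `⊕_d 𝓘_C^{⟨d⟩}(U) X^d` is finitely generated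
on the members `U` of ONE finite family of affine opens covering `Z`, then the door's Veronese shape holds at a common level `b₀ > 0`
(HHT (a) ⇒ (b) per member, product of the levels, stalkwise comparison). NOT a statement of the manuscript.
[cite: HerzogHibiTrung2007, Thm 2.1 (a) ⇒ (b)] [cite: EGAII, Prop (2.1.6)] -/
theorem veronese_of_symbolicAlgebra_fg_cover [IsLocallyNoetherian Z] (C : Closeds Z) (t : Finset Z.affineOpens)
    (ht : ∀ y : Z, ∃ U ∈ t, y ∈ (U : Z.Opens))
    (hFG : ∀ U ∈ t, (familySubalgebra Γ(Z, U) fun d => (diffPower C d).ideal U).FG) :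
    ∃ b₀ : ℕ, 0 < b₀ ∧ ∀ k : ℕ, diffPower C (k * b₀) ≤ diffPower C b₀ ^ k := by
  classical
  -- a standard Veronese level on each member of the cover (level `1`-placeholder off the cover, never used)
  have hlev : ∀ U : Z.affineOpens, ∃ h : ℕ, 0 < h ∧ (U ∈ t →
      ∀ k : ℕ, (diffPower C (k * h)).ideal U ≤ (diffPower C h).ideal U ^ k) := by
    intro U
    by_cases hU : U ∈ t
    · obtain ⟨h, hh, hV⟩ := exists_veronese_of_familySubalgebra_fg (fun d => (diffPower C d).ideal U)
        (ideal_diffPower_zero C U) (ideal_diffPower_mul_le C U) (hFG U hU)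
      exact ⟨h, hh, fun _ k => by rw [mul_comm]; exact (hV k).le⟩
    · exact ⟨1, Nat.one_pos, fun h' => absurd h' hU⟩
  choose h hh hV using hlev
  refine ⟨∏ U ∈ t, h U, Finset.prod_pos fun U _ => hh U, fun k => ?_⟩
  refine le_of_forall_stalkIdeal_le fun y => ?_
  obtain ⟨U, hUt, hyU⟩ := ht y
  have hVU : ∀ k : ℕ, (diffPower C (k * ∏ U ∈ t, h U)).ideal U ≤ (diffPower C (∏ U ∈ t, h U)).ideal U ^ k := by
    intro k
    rw [← Finset.mul_prod_erase t h hUt, mul_comm (h U)]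
    exact veronese_le_pow_mul (fun d => (diffPower C d).ideal U) (ideal_diffPower_zero C U)
      (ideal_diffPower_mul_le C U) (hV U hUt) _ k
  rw [stalkIdeal_eq_map_germ _ U hyU, stalkIdeal_pow, stalkIdeal_eq_map_germ _ U hyU, ← Ideal.map_pow]
  exact Ideal.map_mono (hVU k)

/-- **COVER ⇒ EVERY AFFINE OPEN**: finite generation of the symbolic algebra on the members of one finite affine cover implies it on EVERY
affine open (through the Veronese shape). NOT a statement of the manuscript. [cite: HerzogHibiTrung2007, Thm 2.1] -/
theorem symbolicAlgebra_fg_of_cover [IsLocallyNoetherian Z] (C : Closeds Z) (t : Finset Z.affineOpens)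
    (ht : ∀ y : Z, ∃ U ∈ t, y ∈ (U : Z.Opens))
    (hFG : ∀ U ∈ t, (familySubalgebra Γ(Z, U) fun d => (diffPower C d).ideal U).FG) (V : Z.affineOpens) :
    (familySubalgebra Γ(Z, V) fun d => (diffPower C d).ideal V).FG := by
  obtain ⟨b₀, hb₀, hver⟩ := veronese_of_symbolicAlgebra_fg_cover C t ht hFG
  exact symbolicAlgebra_fg_of_veronese C hb₀ hver V

/-- **AFFINE AMBIENT: ONE ALGEBRA DECIDES.** On an affine locally Noetherian scheme, the door's Veronese shape at `C` holds iff the single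
algebra `⊕_d 𝓘_C^{⟨d⟩}(Z) X^d` (sections over `⊤`) is finitely generated over `Γ(Z, ⊤)`. NOT a statement of the manuscript.
[cite: HerzogHibiTrung2007, Thm 2.1] -/
theorem veronese_iff_symbolicAlgebra_fg_top [IsAffine Z] [IsLocallyNoetherian Z] (C : Closeds Z) :
    (∃ b₀ : ℕ, 0 < b₀ ∧ ∀ k : ℕ, diffPower C (k * b₀) ≤ diffPower C b₀ ^ k) ↔
      (familySubalgebra Γ(Z, (⟨⊤, isAffineOpen_top Z⟩ : Z.affineOpens))
        fun d => (diffPower C d).ideal ⟨⊤, isAffineOpen_top Z⟩).FG := by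
  constructor
  · rintro ⟨b₀, hb₀, hver⟩
    exact symbolicAlgebra_fg_of_veronese C hb₀ hver _
  · intro hFG
    refine veronese_of_symbolicAlgebra_fg_cover C {⟨⊤, isAffineOpen_top Z⟩}
      (fun y => ⟨⟨⊤, isAffineOpen_top Z⟩, Finset.mem_singleton_self _, Opens.mem_top y⟩) fun U hU => ?_
    rw [Finset.mem_singleton] at hU
    subst hU
    exact hFG

/-- **AFFINE AMBIENT: all affine opens ⟺ the top one.** On an affine locally Noetherian scheme the symbolic algebra of `C` is finitely generated
on every affine open iff it is on `Z` itself. NOT a statement of the manuscript. [cite: HerzogHibiTrung2007, Thm 2.1] -/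
theorem symbolicAlgebra_fg_iff_top [IsAffine Z] [IsLocallyNoetherian Z] (C : Closeds Z) :
    (∀ U : Z.affineOpens, (familySubalgebra Γ(Z, U) fun d => (diffPower C d).ideal U).FG) ↔
      (familySubalgebra Γ(Z, (⟨⊤, isAffineOpen_top Z⟩ : Z.affineOpens))
        fun d => (diffPower C d).ideal ⟨⊤, isAffineOpen_top Z⟩).FG := by
  refine ⟨fun h => h _, fun hFG => ?_⟩
  obtain ⟨b₀, hb₀, hver⟩ := (veronese_iff_symbolicAlgebra_fg_top C).mpr hFG
  exact fun U => symbolicAlgebra_fg_of_veronese C hb₀ hver U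

end Cover

end CampaignW36

end Summit.ResolutionOfSingularities.ResolutionOfSingularities.Theorems
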